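import Summits.QuantumFields.BalabanUV.T4Continuum.Support.DirichletSubregionDefect
import Summits.QuantumFields.BalabanUV.T4Continuum.Support.RegionGaugeSliceTorus
import Summits.QuantumFields.BalabanUV.T4Continuum.Support.CovariantBlockAveraging
import Summits.QuantumFields.BalabanUV.T4Continuum.Support.ScalarPlantingDefect

/-!
# T⁴ programme, spine node NE2 (U1a), sub-row Δ1 «NE2⁰-Dirichlet» — THE SLAB NORMAL MODE: a KERNEL NO-GO for a LEVEL-UNIFORM
# gradient-form bound (W2) of the [B9]-faithful single-scale star-bond operator `Δ_a(Ω₀)`; any W2 constant at spacing `1/n` on the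
# one-block slab satisfies `n ≤ a·Cg`

Thirteenth generation of the NE2 prover lineage P1 of the cell `pub-balaban` (row NE2 owner), file 3 (owner item O13-c; ruling R25 (a)
located the mode, this file makes it a theorem).  File 2 of this generation (`Support/DirichletStarVectorTower` p225978) puts leaf-07-g5's
faithful operator `regionDeltaA n M a a′ S` (p223093) on the tower MODULO three displayed inputs, among them W2 — the gradient-form bound
`‖∇_ν ext w‖² ≤ Cg_k·Re⟨w, Δ_a(Ω₀)w⟩` w.r.t. the ZERO-EXTENSION of the star-bond field — with a LEVEL-DEPENDENT constant, and proves
convergence at rate `(√L)⁻¹` in the linear-growth class `Cg_k ≤ Cg₀·L^k`.  THIS FILE proves that class is the MINIMAL one: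

 * §1 the ONE-BLOCK SLAB `slabS M i = {y : y_i = 0}` normal to a direction `i` (`3 ≤ M i`): its star `i`-bonds are exactly the bonds
   `(x, i)` with `(x_i).val < n ∨ (x_i).val = n·M_i − 1` (`star_slab_iff`);
 * §2 THE MODE `slabA = 1` on the star `i`-bonds, `0` on the other components; its zero-extension is the column profile
   `prof (x_i)` (`ext_slabA`); **`curlR_slabA = 0`** (a tangential step does not move the normal coordinate) and **`gradR_conjTranspose_slabA = 0`**
   (region divergence zero: at every site of the slab the inward and outward normal bonds are star bonds carrying the same value), so
   **`form_slabA_le`**: `Re⟨A, Δ_a(Ω₀)A⟩ = a·n^d‖QA‖² ≤ a·‖A‖²` (`‖Q‖² ≤ n^{−d}`);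
 * §3 THE COUNT: sums of functions of `x_i` over the torus factor through the columns (`sum_coord`, `Equiv.piSplitAt`); per column
   `Σ_t prof t ≤ n + 1` and the normal difference quotient jumps at least twice (`two_le_sum_jump`), so `‖A‖² ≤ (n+1)·#columns` and
   `‖∇_i ext A‖² ≥ 2n²·#columns`;
 * §4 **`slab_mode_forces_linear_growth (hMi : 3 ≤ M i) (ha : 0 ≤ a) (ha′ : 0 < a′) (hCg : 0 ≤ Cg)
   (hW2 : ∀ ν w, ‖∇_ν ext w‖² ≤ Cg·Re⟨w, Δ_a(Ω₀)w⟩) : (n : ℝ) ≤ a·Cg`**, and along the tower **`slab_mode_forces_linear_growth_lev`**: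
   `L^k ≤ a·Cg k` — a level-UNIFORM W2 constant for the faithful single-scale operator is REFUTED (census G-ne2p1-g13-2 (a) ↦ theorem;
   the linear-growth class (b) is the open truth; quadratic growth (c) is trivially true and useless).

HONEST FRAMING (T4-DAG p. 1).  `U = 1`; a NO-GO about ONE displayed binder's uniform variant on ONE family of regions (slabs); it says
nothing about W1 (`SliceCoercive`), nothing about interior-norm variants of W2, nothing about Bałaban's multi-zone operator (3.16) whose
collar mass removes this mode; statements / conventions OURS ([folklore]; `[cite:]` tags locate SHAPES); NE2 (U1a) NOT proved; spine 0/9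
unchanged; NOT [B9] (3.23)–(3.27) as printed; NOT infinite volume, NOT a mass gap, NOT the Clay problem, NOT summit progress.  HONEST
DEPENDENCY: continuum YM on T⁴ ⇐ BetaPertH ∧ nine spine estimates (0/9 proved); BetaPertH ⇐ (D1) ∧ (D4) ∧ CAP+tail; G-an2-4 gates
asym, D1 and NE2/3/4.  No `sorry`.
-/

noncomputable section

open scoped BigOperators ComplexConjugate Matrix Matrix.Norms.L2Operator

namespace Summit.QuantumFields.BalabanUV.T4Continuum.DirichletStarSlabMode

open Literature.MathematicalPhysics.QuantumFieldTheory.Balaban1983to89.B5Prop11Plancherel (Tor fine fdiff shiftM unitVec)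
open Literature.MathematicalPhysics.QuantumFieldTheory.Balaban1983to89.B5Prop11Lower (nsq nsq_nonneg)
open Literature.MathematicalPhysics.QuantumFieldTheory.Balaban1983to89.B5G183RateUnitTower (lev)
open Literature.MathematicalPhysics.QuantumFieldTheory.Balaban1983to89.B5Action121 (GradOp CurlOp CurlOp_mulVec Fs_apply
  GradOp_conjTranspose_mulVec_eq divS_apply)
open Literature.MathematicalPhysics.QuantumFieldTheory.Balaban1983to89.B5Block118 (QvOp)
open Literature.MathematicalPhysics.QuantumFieldTheory.Balaban1983to89.B5Blocks16 (blockOf)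
open Summit.QuantumFields.BalabanUV.T4Continuum
open Summit.QuantumFields.BalabanUV.T4Continuum.BalabanAveragedTowerUnit (idx cast_lev')
open Summit.QuantumFields.BalabanUV.T4Continuum.BalabanBlockPoincare (nsq_mulVec_le_rect)
open Summit.QuantumFields.BalabanUV.T4Continuum.SubtypeCompression (ext ext_apply_of ext_apply_of_not nsq_ext)
open Summit.QuantumFields.BalabanUV.T4Continuum.ScalarPlantingDefect (val_blockOf)
open Summit.QuantumFields.BalabanUV.T4Continuum.CovariantBlockAveraging (opNorm_QvOp_le)
open Summit.QuantumFields.BalabanUV.T4Continuum.RegionGaugeProjection (gaugeR)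
open Summit.QuantumFields.BalabanUV.T4Continuum.RegionScalarCompression (QOm GOm)
open Summit.QuantumFields.BalabanUV.T4Continuum.RegionGaugeFixedVector (starReg curlR gradR avgR regionDeltaA form_regionDeltaA)
open Summit.QuantumFields.BalabanUV.T4Continuum.RegionGaugeFixedVectorFlat (avgR_mulVec)
open Summit.QuantumFields.BalabanUV.T4Continuum.RegionGaugeSliceTorus (curlR_mulVec gradR_conjTranspose_mulVec)
open Summit.QuantumFields.BalabanUV.T4Continuum.DirichletSubregionTowerOf (fdiff_mulVec_apply)
open Summit.QuantumFields.BalabanUV.Beta.GAN24.DirichletBoxTrace (blockReg)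

variable {d : ℕ} (n : ℕ) [NeZero n] (M : Fin d → ℕ) [hM : ∀ μ, NeZero (M μ)] (i : Fin d)

/-! ## §1 The one-block slab and its star bonds -/

/-- THE ONE-BLOCK SLAB normal to direction `i`: the unit blocks `y` with `y_i = 0` (it wraps the torus in every other direction). [folklore] -/
def slabS : Tor M → Prop := fun y => y i = 0

/-- decidability of slab membership. [folklore] -/
instance decSlabS : DecidablePred (slabS M i) := fun y => inferInstanceAs (Decidable (y i = 0))

/-- a fine site lies in the slab iff its `i`-coordinate is `< n`. [folklore] -/
theorem blockReg_slab_iff (x : Tor (fine n M)) : blockReg n M (slabS M i) x ↔ (x i).val < n := by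
  have hn : 0 < n := Nat.pos_of_ne_zero (NeZero.ne n)
  show blockOf n M x i = 0 ↔ (x i).val < n
  rw [← ZMod.val_eq_zero, val_blockOf]
  constructor
  · intro h
    by_contra hc
    have := Nat.div_pos (not_lt.mp hc) hn
    omega
  · exact fun h => Nat.div_eq_of_lt h

omit [NeZero n] hM in
/-- a `+e_μ` step with `μ ≠ i` does not move the `i`-coordinate. [folklore] -/
theorem add_unitVec_apply_of_ne (x : Tor (fine n M)) {μ : Fin d} (h : μ ≠ i) : (x + unitVec (fine n M) μ) i = x i := by
  simp [unitVec, Ne.symm h]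

omit [NeZero n] hM in
/-- a `+e_i` step adds one to the `i`-coordinate. [folklore] -/
theorem add_unitVec_apply_self (x : Tor (fine n M)) : (x + unitVec (fine n M) i) i = x i + 1 := by
  simp [unitVec]

omit [NeZero n] hM in
/-- `3n ≤ n·M_i`. [folklore] -/
theorem three_mul_le (hMi : 3 ≤ M i) : 3 * n ≤ fine n M i := by
  show 3 * n ≤ n * M i; rw [mul_comm]; exact Nat.mul_le_mul_left n hMi

/-- the value of a successor on `ZMod N₀`. [folklore] -/
theorem val_add_one {N₀ : ℕ} (hN : 1 < N₀) (t : ZMod N₀) : (t + 1).val = (t.val + 1) % N₀ := by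
  haveI : NeZero N₀ := ⟨by omega⟩
  haveI : Fact (1 < N₀) := ⟨hN⟩
  rw [ZMod.val_add, ZMod.val_one]

/-- **THE STAR `i`-BONDS OF THE SLAB**: `(x, i)` is a star bond iff `(x_i).val < n` (it starts in the slab) or `(x_i).val = n·M_i − 1` (the inward
bond from the last layer of the torus). [folklore] -/
theorem star_slab_iff (hMi : 3 ≤ M i) (x : Tor (fine n M)) :
    starReg n M (slabS M i) (x, i) ↔ (x i).val < n ∨ (x i).val = fine n M i - 1 := by
  have h3 := three_mul_le n M i hMi
  have hn : 1 ≤ n := Nat.pos_of_ne_zero (NeZero.ne n)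
  have hN : 1 < fine n M i := by omega
  have hv : (x i).val < fine n M i := ZMod.val_lt (x i)
  show blockReg n M (slabS M i) x ∨ blockReg n M (slabS M i) (x + unitVec (fine n M) i) ↔ _
  rw [blockReg_slab_iff, blockReg_slab_iff, add_unitVec_apply_self, val_add_one hN]
  rcases Nat.lt_or_ge ((x i).val + 1) (fine n M i) with hlt | hge
  · rw [Nat.mod_eq_of_lt hlt]; omega
  · have heq : (x i).val + 1 = fine n M i := le_antisymm hv hge
    rw [heq, Nat.mod_self]; omega

/-! ## §2 The slab normal mode: curl zero, region divergence zero, only the mass term survives -/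

section Mode

variable (a a' : ℝ)

/-- THE MODE: `1` on every star `i`-bond, `0` on the other components. [folklore] -/
def slabA : {b // starReg n M (slabS M i) b} → ℂ := fun b => if b.1.2 = i then 1 else 0

/-- the column profile of its zero-extension. [folklore] -/
def prof (t : ZMod (fine n M i)) : ℂ := if t.val < n ∨ t.val = fine n M i - 1 then 1 else 0

/-- **the zero-extension of the mode is the column profile on the `i`-components**. [folklore] -/
theorem ext_slabA (hMi : 3 ≤ M i) :
    ext (starReg n M (slabS M i)) (slabA n M i) = fun b => if b.2 = i then prof n M i (b.1 i) else 0 := by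
  funext ⟨x, μ⟩
  by_cases hs : starReg n M (slabS M i) (x, μ)
  · rw [show ext (starReg n M (slabS M i)) (slabA n M i) (x, μ) = slabA n M i ⟨(x, μ), hs⟩ from ext_apply_of _ _ ⟨(x, μ), hs⟩]
    simp only [slabA]
    by_cases hμ : μ = i
    · subst hμ
      rw [if_pos rfl, if_pos rfl, prof, if_pos ((star_slab_iff n M μ hMi x).mp hs)]
    · rw [if_neg hμ, if_neg hμ]
  · rw [ext_apply_of_not _ _ hs]
    by_cases hμ : μ = i
    · subst hμ
      simp only [if_true]
      rw [prof, if_neg (fun h => hs ((star_slab_iff n M μ hMi x).mpr h))]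
    · simp only [hμ, if_false]

/-- **`curl A = 0`**: every plaquette of the zero-extension vanishes (a tangential step does not move the normal coordinate).
[cite: Balaban1984PropagatorsI, (1.2) p.18 (shape)] [folklore] -/
theorem curlR_slabA (hMi : 3 ≤ M i) : curlR n M (slabS M i) *ᵥ slabA n M i = 0 := by
  rw [curlR_mulVec, ext_slabA n M i hMi]
  have h0 : CurlOp (fine n M) (n : ℂ) *ᵥ (fun b : Tor (fine n M) × Fin d => if b.2 = i then prof n M i (b.1 i) else 0) = 0 := by
    funext ⟨x, μ, ν⟩
    rw [CurlOp_mulVec, Fs_apply, Pi.zero_apply]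
    by_cases hμ : μ = i
    · subst hμ
      by_cases hν : ν = μ
      · subst hν; simp
      · simp only [if_true, if_neg hν, add_unitVec_apply_of_ne n M μ x hν]; ring
    · by_cases hν : ν = i
      · subst hν; simp only [if_neg hμ, if_true, add_unitVec_apply_of_ne n M ν x hμ]; ring
      · simp only [if_neg hμ, if_neg hν]; ring
  rw [h0, smul_zero]

/-- the profile is `1` just below a slab site: `prof (t) = 1` whenever `(t + 1).val < n`. [folklore] -/
theorem prof_eq_one_of_succ_lt (hMi : 3 ≤ M i) (t : ZMod (fine n M i)) (h : (t + 1).val < n) : prof n M i t = 1 := by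
  have h3 := three_mul_le n M i hMi
  have hn : 1 ≤ n := Nat.pos_of_ne_zero (NeZero.ne n)
  have hN : 1 < fine n M i := by omega
  have hv : t.val < fine n M i := ZMod.val_lt t
  rw [val_add_one hN] at h
  unfold prof
  rw [if_pos]
  rcases Nat.lt_or_ge (t.val + 1) (fine n M i) with hlt | hge
  · rw [Nat.mod_eq_of_lt hlt] at h; omega
  · omega

/-- **region divergence zero**: `∂_Ωᴴ A = 0` (at a slab site the inward and outward normal bonds are star bonds with the same value).
[cite: Balaban1984PropagatorsI, (1.21) p.21 (shape: ∂*)] [folklore] -/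
theorem gradR_conjTranspose_slabA (hMi : 3 ≤ M i) : (gradR n M (slabS M i))ᴴ *ᵥ slabA n M i = 0 := by
  rw [gradR_conjTranspose_mulVec, ext_slabA n M i hMi]
  funext ⟨x, hx⟩
  show ((GradOp (fine n M) (n : ℂ))ᴴ *ᵥ _) x = 0
  rw [GradOp_conjTranspose_mulVec_eq, divS_apply]
  refine Finset.sum_eq_zero fun μ _ => ?_
  by_cases hμ : μ = i
  · subst hμ
    have hxn : (x μ).val < n := (blockReg_slab_iff n M μ x).mp hx
    have h1 : prof n M μ (x μ) = 1 := by unfold prof; rw [if_pos (Or.inl hxn)]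
    have h2 : prof n M μ ((x - unitVec (fine n M) μ) μ) = 1 := by
      refine prof_eq_one_of_succ_lt n M μ hMi _ ?_
      have e : (x - unitVec (fine n M) μ) μ + 1 = x μ := by simp [unitVec]
      rw [e]; exact hxn
    simp only [if_true, h1, h2, sub_self, mul_zero]
  · simp only [if_neg hμ, sub_self, mul_zero]

/-- **ONLY THE MASS TERM SURVIVES, and it is at most `a‖A‖²`**: `Re⟨A, Δ_a(Ω₀)A⟩ = a·n^d·‖QA‖² ≤ a·‖A‖²` (`‖Q‖² ≤ n^{−d}`).
[cite: Balaban1985BackgroundPropagators, (3.26) p.395 (shape)] [folklore] -/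
theorem form_slabA_le (hMi : 3 ≤ M i) (ha : 0 ≤ a) (ha' : 0 < a') :
    (star (slabA n M i) ⬝ᵥ (regionDeltaA n M a a' (slabS M i) *ᵥ slabA n M i)).re ≤ a * nsq (slabA n M i) := by
  have hnd : (0 : ℝ) < (n : ℝ) ^ d := pow_pos (by exact_mod_cast Nat.pos_of_ne_zero (NeZero.ne n)) d
  rw [form_regionDeltaA n M a a' (slabS M i) ha', curlR_slabA n M i hMi, gradR_conjTranspose_slabA n M i hMi, Matrix.mulVec_zero,
    avgR_mulVec]
  have h0 : nsq (0 : Tor (fine n M) × (Fin d × Fin d) → ℂ) = 0 := by simp [nsq]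
  have h0' : nsq (0 : {x // blockReg n M (slabS M i) x} → ℂ) = 0 := by simp [nsq]
  rw [h0, h0', zero_add, zero_add]
  have hQ : ‖QvOp n M‖ ^ 2 ≤ ((n : ℝ) ^ d)⁻¹ := by
    have h := opNorm_QvOp_le n M
    calc ‖QvOp n M‖ ^ 2 ≤ ((Real.sqrt ((n : ℝ) ^ d))⁻¹) ^ 2 := pow_le_pow_left₀ (norm_nonneg _) h 2
      _ = ((n : ℝ) ^ d)⁻¹ := by rw [inv_pow, Real.sq_sqrt hnd.le]
  calc a * (n : ℝ) ^ d * nsq (QvOp n M *ᵥ ext (starReg n M (slabS M i)) (slabA n M i))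
      ≤ a * (n : ℝ) ^ d * (((n : ℝ) ^ d)⁻¹ * nsq (ext (starReg n M (slabS M i)) (slabA n M i))) := by
        refine mul_le_mul_of_nonneg_left ((nsq_mulVec_le_rect _ _).trans ?_) (mul_nonneg ha hnd.le)
        exact mul_le_mul_of_nonneg_right hQ (nsq_nonneg _)
    _ = a * nsq (slabA n M i) := by rw [nsq_ext, ← mul_assoc, mul_assoc a, mul_inv_cancel₀ hnd.ne', mul_one]

end Mode

/-! ## §3 The count: column decomposition and the two one-dimensional sums -/

section Count

/-- **sums of functions of the `i`-coordinate factor through the columns**: `Σ_x F(x_i) = #columns · Σ_t F t`. [folklore] -/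
theorem sum_coord (F : ZMod (fine n M i) → ℝ) :
    ∑ x : Tor (fine n M), F (x i)
      = (Fintype.card ((j : {j : Fin d // j ≠ i}) → ZMod (fine n M j)) : ℝ) * ∑ t : ZMod (fine n M i), F t := by
  rw [Fintype.sum_equiv (Equiv.piSplitAt i (fun μ => ZMod (fine n M μ))) (fun x => F (x i))
    (fun p => F p.1) (fun x => rfl), Fintype.sum_prod_type]
  simp only [Finset.sum_const, Finset.card_univ, nsmul_eq_mul]
  rw [Finset.mul_sum]

/-- the number of columns is positive. [folklore] -/
theorem card_columns_pos : 0 < Fintype.card ((j : {j : Fin d // j ≠ i}) → ZMod (fine n M j)) :=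
  Fintype.card_pos

omit [NeZero n] hM in
/-- the real column profile `|prof t|²`. [folklore] -/
theorem norm_prof_sq (t : ZMod (fine n M i)) :
    ‖prof n M i t‖ ^ 2 = if t.val < n ∨ t.val = fine n M i - 1 then (1 : ℝ) else 0 := by
  unfold prof; split_ifs <;> simp

/-- **per column the mode has at most `n + 1` bonds**: `Σ_t |prof t|² ≤ n + 1`. [folklore] -/
theorem sum_prof_le : ∑ t : ZMod (fine n M i), ‖prof n M i t‖ ^ 2 ≤ (n : ℝ) + 1 := by
  have h1 : ∀ t : ZMod (fine n M i), ‖prof n M i t‖ ^ 2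
      ≤ (if t.val < n then (1 : ℝ) else 0) + (if t.val = fine n M i - 1 then (1 : ℝ) else 0) := by
    intro t
    rw [norm_prof_sq]
    by_cases hA : t.val < n <;> by_cases hB : t.val = fine n M i - 1
    · rw [if_pos (Or.inl hA), if_pos hA, if_pos hB]; norm_num
    · rw [if_pos (Or.inl hA), if_pos hA, if_neg hB]; norm_num
    · rw [if_pos (Or.inr hB), if_neg hA, if_pos hB]; norm_num
    · rw [if_neg (not_or.mpr ⟨hA, hB⟩), if_neg hA, if_neg hB]; norm_num
  refine (Finset.sum_le_sum fun t _ => h1 t).trans ?_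
  rw [Finset.sum_add_distrib, Finset.sum_boole, Finset.sum_boole]
  have hA : ((Finset.univ.filter fun t : ZMod (fine n M i) => t.val < n).card : ℝ) ≤ n := by
    have h := Finset.card_le_card_of_injOn (s := Finset.univ.filter fun t : ZMod (fine n M i) => t.val < n)
      (t := Finset.range n) (fun t => t.val) (fun t ht => by simpa using ht)
      (fun t₁ _ t₂ _ h => ZMod.val_injective _ h)
    simpa using (show ((Finset.univ.filter fun t : ZMod (fine n M i) => t.val < n).card : ℝ) ≤ (Finset.range n).card by
      exact_mod_cast h)
  have hB : ((Finset.univ.filter fun t : ZMod (fine n M i) => t.val = fine n M i - 1).card : ℝ) ≤ 1 := by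
    have h := Finset.card_le_card_of_injOn (s := Finset.univ.filter fun t : ZMod (fine n M i) => t.val = fine n M i - 1)
      (t := {fine n M i - 1}) (fun t => t.val) (fun t ht => by simpa using ht)
      (fun t₁ _ t₂ _ h => ZMod.val_injective _ h)
    simpa using (show ((Finset.univ.filter fun t : ZMod (fine n M i) => t.val = fine n M i - 1).card : ℝ)
      ≤ ({fine n M i - 1} : Finset ℕ).card by exact_mod_cast h)
  exact add_le_add hA hB

/-- **per column the normal difference quotient of the mode jumps at least twice** (below the slab and at its end):
`2 ≤ Σ_t |prof (t+1) − prof t|²`. [folklore] -/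
theorem two_le_sum_jump (hMi : 3 ≤ M i) :
    (2 : ℝ) ≤ ∑ t : ZMod (fine n M i), ‖prof n M i (t + 1) - prof n M i t‖ ^ 2 := by
  have h3 := three_mul_le n M i hMi
  have hn : 1 ≤ n := Nat.pos_of_ne_zero (NeZero.ne n)
  have hN : 1 < fine n M i := by omega
  -- the two jump points
  set t₁ : ZMod (fine n M i) := ((n - 1 : ℕ) : ZMod (fine n M i)) with ht₁
  set t₂ : ZMod (fine n M i) := ((fine n M i - 2 : ℕ) : ZMod (fine n M i)) with ht₂
  have hv₁ : t₁.val = n - 1 := by rw [ht₁, ZMod.val_cast_of_lt (by omega)]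
  have hv₂ : t₂.val = fine n M i - 2 := by rw [ht₂, ZMod.val_cast_of_lt (by omega)]
  have hv₁' : (t₁ + 1).val = n := by rw [val_add_one hN, hv₁, Nat.mod_eq_of_lt (by omega)]; omega
  have hv₂' : (t₂ + 1).val = fine n M i - 1 := by rw [val_add_one hN, hv₂, Nat.mod_eq_of_lt (by omega)]; omega
  have hne : t₁ ≠ t₂ := by
    intro h; have := congrArg ZMod.val h; rw [hv₁, hv₂] at this; omega
  have hj₁ : ‖prof n M i (t₁ + 1) - prof n M i t₁‖ ^ 2 = 1 := by
    unfold prof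
    rw [hv₁, hv₁', if_neg (show ¬(n < n ∨ n = fine n M i - 1) by omega),
      if_pos (show n - 1 < n ∨ n - 1 = fine n M i - 1 by omega)]
    simp
  have hj₂ : ‖prof n M i (t₂ + 1) - prof n M i t₂‖ ^ 2 = 1 := by
    unfold prof
    rw [hv₂, hv₂', if_pos (Or.inr rfl),
      if_neg (show ¬(fine n M i - 2 < n ∨ fine n M i - 2 = fine n M i - 1) by omega)]
    simp
  calc (2 : ℝ) = ∑ t ∈ ({t₁, t₂} : Finset (ZMod (fine n M i))), ‖prof n M i (t + 1) - prof n M i t‖ ^ 2 := by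
        rw [Finset.sum_pair hne, hj₁, hj₂]; norm_num
    _ ≤ ∑ t, ‖prof n M i (t + 1) - prof n M i t‖ ^ 2 :=
        Finset.sum_le_sum_of_subset_of_nonneg (Finset.subset_univ _) fun _ _ _ => by positivity

/-- **`‖A‖² ≤ (n+1)·#columns`**. [folklore] -/
theorem nsq_slabA_le (hMi : 3 ≤ M i) :
    nsq (slabA n M i) ≤ ((n : ℝ) + 1) * Fintype.card ((j : {j : Fin d // j ≠ i}) → ZMod (fine n M j)) := by
  rw [← nsq_ext (starReg n M (slabS M i)) (slabA n M i), ext_slabA n M i hMi, nsq, Fintype.sum_prod_type]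
  have e : ∀ x : Tor (fine n M), ∑ μ : Fin d, ‖(if μ = i then prof n M i (x i) else 0 : ℂ)‖ ^ 2 = ‖prof n M i (x i)‖ ^ 2 := by
    intro x
    rw [Finset.sum_eq_single i]
    · rw [if_pos rfl]
    · intro μ _ hμ; rw [if_neg hμ, norm_zero, zero_pow two_ne_zero]
    · intro h; exact absurd (Finset.mem_univ _) h
  rw [Finset.sum_congr rfl (fun x _ => e x), sum_coord n M i (fun t => ‖prof n M i t‖ ^ 2)]
  calc (Fintype.card ((j : {j : Fin d // j ≠ i}) → ZMod (fine n M j)) : ℝ) * ∑ t : ZMod (fine n M i), ‖prof n M i t‖ ^ 2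
      ≤ (Fintype.card ((j : {j : Fin d // j ≠ i}) → ZMod (fine n M j)) : ℝ) * ((n : ℝ) + 1) :=
        mul_le_mul_of_nonneg_left (sum_prof_le n M i) (Nat.cast_nonneg _)
    _ = ((n : ℝ) + 1) * Fintype.card ((j : {j : Fin d // j ≠ i}) → ZMod (fine n M j)) := mul_comm _ _

/-- **`2n²·#columns ≤ ‖∇_i ext A‖²`**. [folklore] -/
theorem nsq_fdiff_slabA_ge (hMi : 3 ≤ M i) :
    2 * (n : ℝ) ^ 2 * Fintype.card ((j : {j : Fin d // j ≠ i}) → ZMod (fine n M j))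
      ≤ nsq (fdiff (fine n M) (n : ℂ) i *ᵥ ext (starReg n M (slabS M i)) (slabA n M i)) := by
  rw [ext_slabA n M i hMi, nsq, Fintype.sum_prod_type]
  have e : ∀ x : Tor (fine n M), ∑ μ : Fin d,
      ‖(fdiff (fine n M) (n : ℂ) i *ᵥ fun b : Tor (fine n M) × Fin d => if b.2 = i then prof n M i (b.1 i) else 0) (x, μ)‖ ^ 2
        = (n : ℝ) ^ 2 * ‖prof n M i (x i + 1) - prof n M i (x i)‖ ^ 2 := by
    intro x
    rw [Finset.sum_eq_single i]
    · rw [fdiff_mulVec_apply]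
      simp only [if_true, add_unitVec_apply_self, norm_mul, Complex.norm_natCast, mul_pow]
    · intro μ _ hμ
      rw [fdiff_mulVec_apply]
      simp only [if_neg hμ, sub_self, mul_zero, norm_zero, zero_pow two_ne_zero]
    · intro h; exact absurd (Finset.mem_univ _) h
  rw [Finset.sum_congr rfl (fun x _ => e x), ← Finset.mul_sum,
    sum_coord n M i (fun t => ‖prof n M i (t + 1) - prof n M i t‖ ^ 2)]
  have hC : (0 : ℝ) ≤ Fintype.card ((j : {j : Fin d // j ≠ i}) → ZMod (fine n M j)) := Nat.cast_nonneg _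
  calc 2 * (n : ℝ) ^ 2 * Fintype.card ((j : {j : Fin d // j ≠ i}) → ZMod (fine n M j))
      = (n : ℝ) ^ 2 * (Fintype.card ((j : {j : Fin d // j ≠ i}) → ZMod (fine n M j)) * 2) := by ring
    _ ≤ (n : ℝ) ^ 2 * (Fintype.card ((j : {j : Fin d // j ≠ i}) → ZMod (fine n M j))
          * ∑ t : ZMod (fine n M i), ‖prof n M i (t + 1) - prof n M i t‖ ^ 2) :=
        mul_le_mul_of_nonneg_left (mul_le_mul_of_nonneg_left (two_le_sum_jump n M i hMi) hC) (sq_nonneg _)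

end Count

/-! ## §4 The no-go: a level-uniform W2 constant is impossible for the faithful single-scale operator -/

section NoGo

variable (a a' : ℝ)

/-- **THE SLAB MODE FORCES LINEAR GROWTH OF THE W2 CONSTANT**: if the gradient-form bound of file 2's binder holds at spacing `1/n` on the
one-block slab with constant `Cg`, then `n ≤ a·Cg`. [folklore] -/
theorem slab_mode_forces_linear_growth (hMi : 3 ≤ M i) (ha : 0 ≤ a) (ha' : 0 < a') {Cg : ℝ} (hCg : 0 ≤ Cg)
    (hW2 : ∀ (ν : Fin d) (w : {b // starReg n M (slabS M i) b} → ℂ),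
      nsq (fdiff (fine n M) (n : ℂ) ν *ᵥ ext (starReg n M (slabS M i)) w)
        ≤ Cg * (star w ⬝ᵥ (regionDeltaA n M a a' (slabS M i) *ᵥ w)).re) :
    (n : ℝ) ≤ a * Cg := by
  set C : ℝ := (Fintype.card ((j : {j : Fin d // j ≠ i}) → ZMod (fine n M j)) : ℝ) with hC
  have hCpos : 0 < C := by rw [hC]; exact_mod_cast card_columns_pos n M i
  have hn1 : (1 : ℝ) ≤ n := by exact_mod_cast Nat.pos_of_ne_zero (NeZero.ne n)
  have key : 2 * (n : ℝ) ^ 2 * C ≤ Cg * a * ((n : ℝ) + 1) * C :=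
    calc 2 * (n : ℝ) ^ 2 * C ≤ nsq (fdiff (fine n M) (n : ℂ) i *ᵥ ext (starReg n M (slabS M i)) (slabA n M i)) :=
          nsq_fdiff_slabA_ge n M i hMi
      _ ≤ Cg * (star (slabA n M i) ⬝ᵥ (regionDeltaA n M a a' (slabS M i) *ᵥ slabA n M i)).re := hW2 i (slabA n M i)
      _ ≤ Cg * (a * nsq (slabA n M i)) := mul_le_mul_of_nonneg_left (form_slabA_le n M i a a' hMi ha ha') hCg
      _ ≤ Cg * (a * (((n : ℝ) + 1) * C)) :=
          mul_le_mul_of_nonneg_left (mul_le_mul_of_nonneg_left (nsq_slabA_le n M i hMi) ha) hCg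
      _ = Cg * a * ((n : ℝ) + 1) * C := by ring
  have key' : 2 * (n : ℝ) ^ 2 ≤ Cg * a * ((n : ℝ) + 1) := le_of_mul_le_mul_right key hCpos
  nlinarith [key', hn1, mul_nonneg hCg ha]

end NoGo

/-! ### Along the tower: `L^k ≤ a·Cg k` -/

section Lev

variable (L : ℕ) [NeZero L] (a a' : ℝ)

/-- **ALONG THE TOWER**: any constants `Cg k` in file 2's W2 binder for the slab satisfy `L^k ≤ a·Cg k` at every level — a
level-UNIFORM W2 constant for the faithful single-scale star-bond operator is impossible; the linear-growth class of
`DirichletStarVectorTower.towerLimitRate_star_of_linear` is the minimal one. [folklore] -/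
theorem slab_mode_forces_linear_growth_lev (hMi : 3 ≤ M i) (ha : 0 ≤ a) (ha' : 0 < a') {Cg : ℕ → ℝ} (hCg : ∀ k, 0 ≤ Cg k)
    (hW2 : ∀ (k : ℕ) (ν : Fin d) (w : {b // starReg (lev L k) M (slabS M i) b} → ℂ),
      nsq (fdiff (fine (lev L k) M) ((lev L k : ℕ) : ℂ) ν *ᵥ ext (starReg (lev L k) M (slabS M i)) w)
        ≤ Cg k * (star w ⬝ᵥ (regionDeltaA (lev L k) M a a' (slabS M i) *ᵥ w)).re) (k : ℕ) :
    (L : ℝ) ^ k ≤ a * Cg k := by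
  rw [← cast_lev' L k]
  exact slab_mode_forces_linear_growth (lev L k) M i a a' hMi ha ha' (hCg k) (hW2 k)

end Lev

end Summit.QuantumFields.BalabanUV.T4Continuum.DirichletStarSlabMode

end
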